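import Literature.NumberTheory.EllipticCurves.BSDInvariants
import HarnessLib

/-!
# Discharges of named facts of `BSDInvariants.lean`: the real period of a model over `ℚ`

Sibling file of `Literature.NumberTheory.EllipticCurves.BSDInvariants` (D-0014 keeps `Literature/`
sorry-free by stating cited results as named facts `def X : Prop`; a discharge is a
`theorem X_holds : X`). Proved here, for a Weierstrass equation `W` over `ℚ`:

* `WeierstrassCurve.realPeriodRat_smul` (`Ω(C • W) = |u| · Ω(W)` for every rational change of
  variables `C` and every model, elliptic or not): from the discharged statement over `ℝ`,
  `WeierstrassCurve.realPeriod_smul_holds` (`RealPeriod`), and Mathlib's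
  `WeierstrassCurve.map_variableChange` (base change to `ℝ` commutes with `C •`).
* `WeierstrassCurve.realPeriodRat_variableChange_of_isGloballyMinimal` (two globally minimal
  models of an elliptic curve over `ℚ` have the same real period, so that the BSD period `Ω(E)` is
  well defined): from the previous item and the discharged uniqueness of the global minimal model
  up to `u = ±1`, `WeierstrassCurve.isGloballyMinimal_unique_holds` (`GlobalMinimalModel`).

`realPeriodRat_pos` is discharged elsewhere (`WeierstrassCurve.realPeriodRat_pos_holds` in
`ComplexMultiplicationBurungaleFlachProofs`). The remaining named facts of the `Rat` section of
`BSDInvariants.lean` (`bsdRHS_pos`, `bsdRHS_variableChange_of_isGloballyMinimal`,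
`bsdTriple_variableChange_of_isGloballyMinimal`, `bsdLeadingTermFormula_iff_re`,
`leadingLCoeff_im_eq_zero`) depend on facts that are not yet discharged (`tamagawaProduct_pos`,
`tamagawaProduct_variableChange`, `regulator_variableChange`, `leadingLCoeff_im_eq_zero`) and are
not treated here.

## References

* J. H. Silverman, *The Arithmetic of Elliptic Curves*, 2nd ed., GTM 106 (2009), III.1 (Table 3.1),
  VII.1.3(b), VIII.8.3, C.16.
* A. Wiles, *The Birch and Swinnerton-Dyer conjecture*, Clay Mathematics Institute (2006), §1.
-/

noncomputable section

open scoped Classical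

namespace WeierstrassCurve

variable (W : WeierstrassCurve ℚ)

/-- **Silverman, *AEC* III.1, Table 3.1** (`u⁻¹ω' = ω`): `Ω(C • W) = |u| · Ω(W)` for every
Weierstrass equation `W` over `ℚ` and every admissible change of variables `C` over `ℚ`.
Discharge of the named fact `realPeriodRat_smul`: base change to `ℝ` commutes with `C •`
(`WeierstrassCurve.map_variableChange`), and over `ℝ` this is `realPeriod_smul_holds`.
[cite: SilvermanAEC2009, §III.1 Table 3.1] -/
private theorem realPeriodRat_smul_holds : W.realPeriodRat_smul := by
  intro C
  simp only [realPeriodRat_def, baseChange]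
  rw [← map_variableChange, (W.map (algebraMap ℚ ℝ)).realPeriod_smul_holds]
  simp

/-- **Silverman, *AEC* VIII.8.3 with VII.1.3(b), and C.16** (`Ω` is attached to `E/ℚ` through a
global minimal Weierstrass equation): two globally minimal models of an elliptic curve over `ℚ`
have the same real period, since they differ by a change of variables with `u = ±1`
(`isGloballyMinimal_unique_holds`) and `Ω(C • W) = |u| · Ω(W)` (`realPeriodRat_smul_holds`).
Discharge of the named fact `realPeriodRat_variableChange_of_isGloballyMinimal`.
[cite: SilvermanAEC2009, VIII.8.3 with VII.1 Prop. 1.3(b)] -/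
private theorem realPeriodRat_variableChange_of_isGloballyMinimal_holds [W.IsElliptic] :
    W.realPeriodRat_variableChange_of_isGloballyMinimal := by
  intro _ C _
  rw [W.realPeriodRat_smul_holds C]
  rcases (isGloballyMinimal_unique_holds W C).1 with h | h <;> simp [h]

end WeierstrassCurve

end
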